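import Summits.CriticalPhenomena.SAWScalingLimit.Theses.SAWLeftRightFKG
import Summits.CriticalPhenomena.SAWScalingLimit.Theses.SAWBrownianDomination

/-!
# Crux-ideate sketches (ideator 1, round 1) for crux `FKGToTraversalBound`
(stmt-CriticalPhenomena-1878; `LeftRightFKG → SAWTraversalBound`).

First lemmas of the two idea cards, typed over existing declarations only:

* card `lid-collapse-needle`:
  `SlotCollapseMono` (the collapse step (M−) of positive association in its smallest concrete
  family: shortening the box on the side OPPOSITE to a pocket raises the pocket-dive probability),
  `FlaskEnlargeMono` (the shave/enlarge step (M+)), and the seed `NeedleNonDegeneracy`.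
* card `brownian-domination-closes-g2`:
  `RWSlotFjordBound` (the random-walk side: killed SRW path measure rarely reaches the bottom of
  a deep slot) and the transfer shape `UDTransfer`.

Mesh `δ = 1`; lattice regions are given as open subsets of `ℂ` whose mesh vertices are the
intended sites (unions of open rectangles with integer corners), so `meshDomain` is the whole
(connected) site set and `discreteDomainGraph` is the induced grid graph.
-/

namespace Summit.CriticalPhenomena.SAWScalingLimit.Cruxes.FKGToTraversalBound.Ideator1

open Literature.Probability.LatticeModels Literature.Probability.RandomPlanarGeometry
open scoped ENNReal

noncomputable section

/-! ### Concrete lattice regions (mesh 1) -/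

/-- Open box `(0,n+1) × (0,m+1)` (sites `{1..n} × {1..m}`) with a slot of width `w` and depth `d`
hanging below columns `i₀+1 … i₀+w` (slot sites `{i₀+1..i₀+w} × {1-d..0}`). The chord runs from
`(1,1)` to `(n,1)`; the slot hangs off the bottom side, i.e. off the boundary arc OPPOSITE to the
top/left/right sides. -/
def slotRegion (n m i₀ w d : ℕ) : Set ℂ :=
  {z | 0 < z.re ∧ z.re < n + 1 ∧ 0 < z.im ∧ z.im < m + 1} ∪
  {z | (i₀ : ℝ) < z.re ∧ z.re < i₀ + w + 1 ∧ -(d : ℝ) < z.im ∧ z.im < 1}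

/-- Same box and a pocket with a NECK of width `w` (row `0`) opening into a flask body of width
`w + 2e` (rows `-1 … 1-d`): the slot enlarged on the pocket side below its neck. -/
def flaskRegion (n m i₀ w d e : ℕ) : Set ℂ :=
  {z | 0 < z.re ∧ z.re < n + 1 ∧ 0 < z.im ∧ z.im < m + 1} ∪
  {z | (i₀ : ℝ) < z.re ∧ z.re < i₀ + w + 1 ∧ -(1 : ℝ) < z.im ∧ z.im < 1} ∪
  {z | (i₀ : ℝ) - e < z.re ∧ z.re < i₀ + w + 1 + e ∧ -(d : ℝ) < z.im ∧ z.im < 0}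

/-- The dive event: the chord visits the bottom row `y = 1 - d` of the pocket. -/
def dives {Ω : Set ℂ} {a b : Site 2} (d : ℕ) : Set (SAW.DomainSAW Ω 1 a b) :=
  {γ | ∃ v ∈ γ.walk.support, v 1 = 1 - (d : ℤ)}

/-- Bottom-left and bottom-right corners of the box. -/
def cornerL : Site 2 := ![1, 1]
/-- see `cornerL` -/
def cornerR (n : ℕ) : Site 2 := ![(n : ℤ), 1]

/-! ### Card `lid-collapse-needle` -/

/-- **(M−) collapse monotonicity, smallest family.** Under `LeftRightFKG`, removing the top row of
the box (a hull attached to the arc opposite to the slot) can only RAISE the probability that the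
corner-to-corner critical SAW chord dives to the bottom of the slot: `m ↦ P_m(dive)` is
non-increasing, so the fully collapsed lid `m = 1` is the worst case. (Exact enumeration, exp/N1:
8 families `n ≤ 7`, all three fugacities in `[1/2.7, 1/2.6]`, monotone.) A certified violation
refutes `LeftRightFKG` itself. -/
def SlotCollapseMono : Prop :=
  ∀ n m i₀ w d : ℕ, 1 ≤ m → 1 ≤ w → 1 ≤ d → 1 ≤ i₀ → i₀ + w < n →
    SAW.law (slotRegion n (m + 1) i₀ w d) 1 cornerL (cornerR n) (dives d) ≤
      SAW.law (slotRegion n m i₀ w d) 1 cornerL (cornerR n) (dives d)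

/-- The collapse step is a consequence of the route's positive association (what the line uses
`LeftRightFKG` for, and only this). -/
def CollapseFromPA : Prop :=
  Summit.CriticalPhenomena.SAWScalingLimit.Theses.SAWLeftRightFKG.LeftRightFKG → SlotCollapseMono

/-- **(M+) shave/enlarge monotonicity, smallest family.** Enlarging the pocket on ITS OWN side
below the neck (slot ↦ flask), with the target extended to the new bottom row (still attached to
the pocket walls), can only raise the dive probability. (exp/mplus: +18–31 % at `n ≤ 7`.) -/
def FlaskEnlargeMono : Prop :=
  ∀ n m i₀ w d e : ℕ, 1 ≤ m → 1 ≤ w → 2 ≤ d → e + 1 ≤ i₀ → i₀ + w + e < n →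
    SAW.law (slotRegion n m i₀ w d) 1 cornerL (cornerR n) (dives d) ≤
      SAW.law (flaskRegion n m i₀ w d e) 1 cornerL (cornerR n) (dives d)

/-- The needle box: open square `(-(n+1), n+1)²` slit along the closed vertical segment from the
top side down to the centre `0` (sites `{-n..n}² ∖ {0} × {0..n}`), mesh `1`. The chord is pinned at
the two sites flanking the root of the needle, `(-1, n)` and `(1, n)`, so together with the root it
is a critical self-avoiding polygon surrounding the needle; the outer square is the (collapsed)
lid, the needle is the spine. -/
def needleRegion (n : ℕ) : Set ℂ :=
  {z | |z.re| < n + 1 ∧ |z.im| < n + 1} \ {z | z.re = 0 ∧ 0 ≤ z.im}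

/-- Grazing the tip: the chord visits a site within sup-distance `s` of the needle tip `0`. -/
def grazes (n s : ℕ) : Set (SAW.DomainSAW (needleRegion n) 1 ![-1, (n : ℤ)] ![1, (n : ℤ)]) :=
  {γ | ∃ v ∈ γ.walk.support, |v 0| ≤ s ∧ |v 1| ≤ s}

/-- **Seed: needle non-degeneracy** (the reduced form of KS Condition G2 for the x_c-SAW under
positive association, straight spine): a critical SAW chord pinned at the root of a needle in a
box of half-width `n` passes within `s` of the tip with probability at most `1/2` once `n ≥ C₀ s`.
Conformal prediction `≍ (s/n)^{1}` (two legs at a `2π`-wedge tip); open. -/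
def NeedleNonDegeneracy : Prop :=
  ∃ C₀ : ℕ, 1 ≤ C₀ ∧ ∀ s n : ℕ, 1 ≤ s → C₀ * s ≤ n →
    SAW.law (needleRegion n) 1 ![-1, (n : ℤ)] ![1, (n : ℤ)] (grazes n s) ≤ 2⁻¹

/-! ### Card `brownian-domination-closes-g2` -/

/-- The killed simple-random-walk path measure of `Ω₁` (weight `4^{-|ω|}` on ALL nearest-neighbour
walks of the discrete domain graph from `a` to `b`; the normalising object of the Brownian
domination inequality `UniformDomination`), evaluated on a set of walks. -/
def rwMass (Ω : Set ℂ) (a b : Site 2) (E : Set ((discreteDomainGraph Ω 1).Walk a b)) : ℝ≥0∞ :=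
  ∑' ω : (discreteDomainGraph Ω 1).Walk a b, Set.indicator E (fun ω' => (4 : ℝ≥0∞)⁻¹ ^ ω'.length) ω

/-- **Random-walk fjord bound (slot family).** For the killed SRW path measure from corner to
corner, reaching the bottom of a slot of width `w` and depth `d` costs `K e^{-c d / w}` (spectral
gap of the slot's Dirichlet Laplacian; a theorem-grade harmonic estimate, the lattice shadow of
Beurling / extremal length). This is the random-walk side of the G2 bound once Brownian
domination transfers it to the SAW. -/
def RWSlotFjordBound : Prop :=
  ∃ K c : ℝ, 0 < K ∧ 0 < c ∧ ∀ n m i₀ w d : ℕ, 1 ≤ m → 1 ≤ w → 1 ≤ d → 1 ≤ i₀ → i₀ + w < n →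
    rwMass (slotRegion n m i₀ w d) cornerL (cornerR n)
        {ω | ∃ v ∈ ω.support, v 1 = 1 - (d : ℤ)} ≤
      ENNReal.ofReal (K * Real.exp (-c * d / w)) *
        rwMass (slotRegion n m i₀ w d) cornerL (cornerR n) Set.univ

/-- **Transfer shape of the second card**: the Brownian-domination crux of route
`SAWBrownianDomination` already implies the consequent of this crux (Kemppainen–Smirnov never ask
about annuli whose inner disk misses `∂U_τ`; every unforced crossing is a deep visit into a
dead-end fjord of the slit domain, a pure obstacle-hitting event), so `FKGToTraversalBound`
closes a fortiori. -/
def UDTransfer : Prop :=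
  Summit.CriticalPhenomena.SAWScalingLimit.Theses.SAWBrownianDomination.UniformDomination →
    Summit.CriticalPhenomena.SAWScalingLimit.Theses.SAWLeftRightFKG.SAWTraversalBound

/-- Bookkeeping: the transfer closes the crux (the hypothesis `LeftRightFKG` is not consumed). -/
theorem crux_of_UDTransfer (h : UDTransfer)
    (hUD : Summit.CriticalPhenomena.SAWScalingLimit.Theses.SAWBrownianDomination.UniformDomination) :
    Summit.CriticalPhenomena.SAWScalingLimit.Theses.SAWLeftRightFKG.FKGToTraversalBound :=
  fun _ => h hUD

end

end Summit.CriticalPhenomena.SAWScalingLimit.Cruxes.FKGToTraversalBound.Ideator1
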